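import Summits.MatrixMultiplication.OmegaCensus.BoxBadAtomsSmallQ
import Summits.MatrixMultiplication.OmegaCensus.BoxBadAtomsCyclotomicBridge

/-!
# ω-census, family (b3): conjecture C9 (b) with the atom hypothesis LOCALISED to the primes of `|G|`; C9 (b) for solvable `{2,3,5}`-groups

HONEST FRAMING (pub-omega census; verbatim): lottery ticket; floor = certified bounds/negative ranges.
Census BOOKKEEPING (conjecture C9 of the cell, STRUCTURE.md §2, `BoxRatioSectionLaw`; pub-omega kernel-l4 gen 17, task K-5″).
Nothing here is progress on `ω`.

The reduction of `BoxRatioSectionLawAtoms` uses the atom hypothesis `AtomBad p q` only for configurations found INSIDE the group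
at hand, hence only for primes `p, q` dividing its order (`AtomConfig.dvd_card`: `a` has order `p`, and `q ∣ |y|`); and the
induction passes to subgroups and quotients, whose orders divide `|G|`.  So:
* **`boxRatioSectionLaw_of_isSolvable_of_atomBad_local`** — a box-useful finite solvable group `G` is lawful provided `AtomBad p q`
  holds for the distinct primes `p, q` DIVIDING `|G|` with `q ≥ 5` (the pairs with `q ≤ 3` are in the tree, `atomBad_of_lt_five`).
* **`boxRatioSectionLaw_of_isSolvable_two_three_five`** — UNCONDITIONALLY: conjecture C9 (b) holds for every finite solvable
  group of order `2^a 3^b 5^c` (the only pairs with `q ≥ 5` are `(2,5)` and `(3,5)`: `atomBad_2_5`, `atomBad_3_5`, the atoms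
  `𝔽₁₆ ⋊ C₅`, `𝔽₈₁ ⋊ C₅` of stpp-1 in relation form).  This extends gen 16's `{2,3}`-theorem by the prime `5`.
-/

namespace Summit.MatrixMultiplication.OmegaCensus

universe u

/-- **The primes of a configuration divide the group order**: in `AtomConfig p q a y` with `p ≠ q` primes, `a` has order `p`
and `q ∣ |y|` (otherwise `y` would be a power of `y^q`, which centralises `a`). [folklore] -/
theorem AtomConfig.dvd_card {G : Type*} [Group G] [Fintype G] {p q : ℕ} {a y : G} (h : AtomConfig p q a y) (hp : p.Prime)
    (hq : q.Prime) (hpq : p ≠ q) : p ∣ Fintype.card G ∧ q ∣ Fintype.card G := by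
  haveI : Fact p.Prime := ⟨hp⟩
  have hne := h.conj_ne hp hq hpq
  obtain ⟨ha1, hap, -, hyq, -⟩ := h
  refine ⟨?_, ?_⟩
  · rw [← orderOf_eq_prime hap ha1]; exact orderOf_dvd_card
  · have hqy : q ∣ orderOf y := by
      by_contra hnd
      have hcop : q.Coprime (orderOf y) := (Nat.Prime.coprime_iff_not_dvd hq).2 hnd
      obtain ⟨m, hm⟩ := exists_pow_eq_self_of_coprime hcop
      have hc : Commute (y ^ q) a := by
        rw [commute_iff_eq]; exact (mul_inv_eq_iff_eq_mul.1 hyq)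
      have hc' : Commute y a := by rw [← hm]; exact hc.pow_left m
      exact hne (mul_inv_eq_iff_eq_mul.2 hc'.eq)
    exact hqy.trans orderOf_dvd_card

namespace AtomReduction

/-- The heart of the induction with the LOCALISED atom hypothesis (only primes dividing `|G|`); same proof as
`false_of_prime_dvd_card`. [folklore] -/
theorem false_of_prime_dvd_card_local {G : Type u} [Group G] [Fintype G] [DecidableEq G] [IsSolvable G]
    (hAtom : ∀ p q : ℕ, p.Prime → q.Prime → p ≠ q → p ∣ Fintype.card G → q ∣ Fintype.card G → (5 ≤ p ∨ 5 ≤ q) →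
      AtomBad.{u} p q)
    (hG : BoxUseful G) (hZ : Subgroup.center G = ⊥) [Nontrivial G]
    (IH : ∀ (K : Subgroup G) [Fintype K], K ≠ ⊤ → BoxUseful K →
      (Subgroup.center K).index = 1 ∨ (Subgroup.center K).index = 4 ∨ (Subgroup.center K).index = 6 ∨
        ∃ (c₁ c₂ : K) (κ₁ κ₂ ε : K → ZMod 3), DihC3Sq.Coord2 c₁ c₂ κ₁ κ₂ ε)
    {r : ℕ} (hr : r.Prime) (hr5 : 5 ≤ r) (hrd : r ∣ Fintype.card G) : False := by
  classical
  have hbad : ∀ (p q : ℕ) (a y : G), p.Prime → q.Prime → p ≠ q → (5 ≤ p ∨ 5 ≤ q) → AtomConfig p q a y → False := by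
    intro p q a y hp hq hpq h5 hconf
    obtain ⟨hpd, hqd⟩ := hconf.dvd_card hp hq hpq
    exact hAtom p q hp hq hpq hpd hqd h5 G a y hconf hG
  have hVZ : ∀ v : G, (∀ g : G, g * v = v * g) → v = 1 := by
    intro v hv
    have : v ∈ Subgroup.center G := Subgroup.mem_center_iff.2 hv
    rwa [hZ, Subgroup.mem_bot] at this
  obtain ⟨V, hVn, hV1, -, hVab, p, hp, -, hVp⟩ := Endgame.exists_minimal_normal G
  haveI := hVn
  by_cases hpr : p = r
  · subst hpr
    obtain ⟨q, a, y, hq, hqp, -, hconf⟩ := exists_atomConfig_of_normal hp V hVab hVp hV1 (fun v _ hv => hVZ v hv)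
    exact hbad p q a y hp hq (Ne.symm hqp) (Or.inl hr5) hconf
  · have hzC : ∀ z : G, z ^ r = 1 → ∀ v ∈ V, z * v * z⁻¹ = v := by
      intro z hz
      by_contra hcon
      push Not at hcon
      obtain ⟨a, -, hconf⟩ := exists_atomConfig (p := p) (q := r) hVab hVp (fun v hv => hVn.conj_mem v hv z) hcon
        (fun v _ => by rw [hz]; simp)
      exact hbad p r a z hp hr hpr (Or.inr hr5) hconf
    haveI hCn : (Subgroup.centralizer (V : Set G)).Normal := inferInstance
    set C := Subgroup.centralizer (V : Set G) with hCdef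
    have hC : ∀ g : G, g ∈ C ↔ ∀ v ∈ V, g * v * g⁻¹ = v := by
      intro g
      rw [hCdef, Subgroup.mem_centralizer_iff]
      refine ⟨fun h v hv => ?_, fun h v hv => ?_⟩
      · rw [mul_inv_eq_iff_eq_mul, h v hv]
      · exact (mul_inv_eq_iff_eq_mul.1 (h v hv)).symm
    have hCtop : C ≠ ⊤ := by
      intro htop
      obtain ⟨v, hvV, hv1⟩ : ∃ v ∈ V, v ≠ (1 : G) := by
        by_contra! h
        exact hV1 ((Subgroup.eq_bot_iff_forall _).2 h)
      refine hv1 (hVZ v fun g => ?_)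
      have hg : g ∈ C := by rw [htop]; exact Subgroup.mem_top g
      exact mul_inv_eq_iff_eq_mul.1 ((hC g).1 hg v hvV)
    have hClaw := IH C hCtop (hG.subgroup C)
    have hzZ : ∀ z : G, z ^ r = 1 → ∀ c ∈ C, c * z = z * c := by
      intro z hz c hc
      have hzC' : z ∈ C := (hC z).2 (hzC z hz)
      have hz' : (⟨z, hzC'⟩ : C) ^ r = 1 := Subtype.ext (by simp [hz])
      have hmem := mem_center_of_lawful hClaw hr hr5 hz'
      rw [Subgroup.mem_center_iff] at hmem
      have := hmem ⟨c, hc⟩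
      exact congrArg Subtype.val this
    let T : Subgroup G :=
      { carrier := {z | z ∈ C ∧ z ^ r = 1}
        one_mem' := ⟨C.one_mem, one_pow r⟩
        mul_mem' := fun {z w} hz hw => ⟨C.mul_mem hz.1 hw.1, by
          have hcomm : Commute z w := (hzZ z hz.2 w hw.1).symm
          rw [hcomm.mul_pow, hz.2, hw.2, one_mul]⟩
        inv_mem' := fun {z} hz => ⟨C.inv_mem hz.1, by rw [inv_pow, hz.2, inv_one]⟩ }
    have hT : ∀ z : G, z ∈ T ↔ z ∈ C ∧ z ^ r = 1 := fun z => Iff.rfl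
    haveI hTn : T.Normal := ⟨fun z hz g => (hT _).2 ⟨hCn.conj_mem z ((hT z).1 hz).1 g, by
      rw [CentreLift.conj_pow', ((hT z).1 hz).2]; group⟩⟩
    have hTab : ∀ z ∈ T, ∀ w ∈ T, z * w = w * z :=
      fun z hz w hw => (hzZ z ((hT z).1 hz).2 w ((hT w).1 hw).1).symm
    have hTr : ∀ z ∈ T, z ^ r = 1 := fun z hz => ((hT z).1 hz).2
    have hT1 : T ≠ ⊥ := by
      haveI : Fact r.Prime := ⟨hr⟩
      obtain ⟨z₀, hz₀⟩ := exists_prime_orderOf_dvd_card r hrd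
      have hz₀r : z₀ ^ r = 1 := by rw [← hz₀, pow_orderOf_eq_one]
      have hz₀T : z₀ ∈ T := (hT z₀).2 ⟨(hC z₀).2 (hzC z₀ hz₀r), hz₀r⟩
      intro hbot
      rw [hbot, Subgroup.mem_bot] at hz₀T
      rw [hz₀T, orderOf_one] at hz₀
      exact hr.one_lt.ne hz₀
    obtain ⟨q, a, y, hq, hqr, -, hconf⟩ := exists_atomConfig_of_normal hr T hTab hTr hT1 (fun v _ hv => hVZ v hv)
    exact hbad r q a y hr hq (Ne.symm hqr) (Or.inl hr5) hconf

/-- **C9 (b) for finite solvable groups with the localised atom hypothesis** (induction on the order; the hypothesis descends to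
subgroups and quotients because their orders divide `|G|`). [folklore] -/
theorem lawful_of_isSolvable_of_atomBad_local_aux (n : ℕ) :
    ∀ (G : Type u) [Group G] [Fintype G] [DecidableEq G] [IsSolvable G], Fintype.card G = n →
      (∀ p q : ℕ, p.Prime → q.Prime → p ≠ q → p ∣ Fintype.card G → q ∣ Fintype.card G → (5 ≤ p ∨ 5 ≤ q) →
        AtomBad.{u} p q) → BoxUseful G →
      (Subgroup.center G).index = 1 ∨ (Subgroup.center G).index = 4 ∨ (Subgroup.center G).index = 6 ∨
        ∃ (c₁ c₂ : G) (κ₁ κ₂ ε : G → ZMod 3), DihC3Sq.Coord2 c₁ c₂ κ₁ κ₂ ε := by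
  induction n using Nat.strong_induction_on with
  | _ n IH =>
  intro G _ _ _ _ hn hAtom hG
  classical
  by_cases hZ : Subgroup.center G = ⊥
  swap
  · apply CentreLift.lawful_of_law_on_quotient hG
    intro hq
    have hlt : Fintype.card (G ⧸ Subgroup.center G) < n := by
      rw [← hn, ← Nat.card_eq_fintype_card, ← Nat.card_eq_fintype_card,
        Subgroup.card_eq_card_quotient_mul_card_subgroup (Subgroup.center G)]
      exact lt_mul_of_one_lt_right Nat.card_pos ((Subgroup.center G).one_lt_card_iff_ne_bot.2 hZ)
    have hdvd : Fintype.card (G ⧸ Subgroup.center G) ∣ Fintype.card G := by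
      rw [← Nat.card_eq_fintype_card, ← Nat.card_eq_fintype_card]
      exact Subgroup.card_quotient_dvd_card _
    exact IH _ hlt (G ⧸ Subgroup.center G) rfl
      (fun p q hp hq hpq hpd hqd h5 => hAtom p q hp hq hpq (hpd.trans hdvd) (hqd.trans hdvd) h5) hq
  · by_cases htriv : Nontrivial G
    swap
    · left
      haveI : Subsingleton G := not_nontrivial_iff_subsingleton.1 htriv
      rw [Subgroup.index_eq_one, eq_top_iff]
      intro x _
      rw [Subgroup.mem_center_iff]
      intro g
      rw [Subsingleton.elim x 1, mul_one, one_mul]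
    · have IH' : ∀ (K : Subgroup G) [Fintype K], K ≠ ⊤ → BoxUseful K →
          (Subgroup.center K).index = 1 ∨ (Subgroup.center K).index = 4 ∨ (Subgroup.center K).index = 6 ∨
            ∃ (c₁ c₂ : K) (κ₁ κ₂ ε : K → ZMod 3), DihC3Sq.Coord2 c₁ c₂ κ₁ κ₂ ε := by
        intro K _ hK hKu
        have hlt : Fintype.card K < n := by
          rw [← hn, ← Nat.card_eq_fintype_card, ← Nat.card_eq_fintype_card, ← K.card_mul_index]
          exact lt_mul_of_one_lt_right Nat.card_pos (Subgroup.one_lt_index_of_ne_top hK)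
        have hdvd : Fintype.card K ∣ Fintype.card G := by
          rw [← Nat.card_eq_fintype_card, ← Nat.card_eq_fintype_card]
          exact Subgroup.card_subgroup_dvd_card K
        exact IH _ hlt K rfl (fun p q hp hq hpq hpd hqd h5 => hAtom p q hp hq hpq (hpd.trans hdvd) (hqd.trans hdvd) h5) hKu
      have h23 : ∀ r : ℕ, r.Prime → r ∣ Fintype.card G → r = 2 ∨ r = 3 := by
        intro r hr hrd
        by_contra hne
        push Not at hne
        exact false_of_prime_dvd_card_local hAtom hG hZ IH' hr (hr.five_le_of_ne_two_of_ne_three hne.1 hne.2) hrd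
      exact boxRatioSectionLaw_of_isSolvable G h23 hG

end AtomReduction

/-- **C9 (b) for finite solvable groups, atoms localised to the primes of `|G|`**: if `AtomBad p q` holds for all distinct
primes `p, q` dividing `|G|` with `q ≥ 5`, then a box-useful finite solvable `G` has centre of index `1`, `4` or `6`, or lies in
`𝒞₂`. [folklore] -/
theorem boxRatioSectionLaw_of_isSolvable_of_atomBad_local (G : Type u) [Group G] [Fintype G] [DecidableEq G] [IsSolvable G]
    (hAtom : ∀ p q : ℕ, p.Prime → q.Prime → p ≠ q → p ∣ Fintype.card G → q ∣ Fintype.card G → 5 ≤ q → AtomBad.{u} p q)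
    (hG : BoxUseful G) :
    (Subgroup.center G).index = 1 ∨ (Subgroup.center G).index = 4 ∨ (Subgroup.center G).index = 6 ∨
      ∃ (c₁ c₂ : G) (κ₁ κ₂ ε : G → ZMod 3), DihC3Sq.Coord2 c₁ c₂ κ₁ κ₂ ε := by
  refine AtomReduction.lawful_of_isSolvable_of_atomBad_local_aux (Fintype.card G) G rfl
    (fun p q hp hq hpq hpd hqd h5 => ?_) hG
  by_cases hq5 : 5 ≤ q
  · exact hAtom p q hp hq hpq hpd hqd hq5
  · exact atomBad_of_lt_five hp hq hpq h5 (not_le.1 hq5)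

/-- **Conjecture C9 (b) holds for every finite solvable group of order `2^a 3^b 5^c`** (unconditionally): a box-useful such group
has centre of index `1`, `4` or `6`, or lies in `𝒞₂`.  The atoms needed are `A(2,5) = 𝔽₁₆ ⋊ C₅` and `A(3,5) = 𝔽₈₁ ⋊ C₅`
(`SchmidtAtoms.atomBad_2_5`, `SchmidtAtoms.atomBad_3_5`). [folklore] -/
theorem boxRatioSectionLaw_of_isSolvable_two_three_five (G : Type u) [Group G] [Fintype G] [DecidableEq G] [IsSolvable G]
    (h235 : ∀ r : ℕ, r.Prime → r ∣ Fintype.card G → r = 2 ∨ r = 3 ∨ r = 5) (hG : BoxUseful G) :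
    (Subgroup.center G).index = 1 ∨ (Subgroup.center G).index = 4 ∨ (Subgroup.center G).index = 6 ∨
      ∃ (c₁ c₂ : G) (κ₁ κ₂ ε : G → ZMod 3), DihC3Sq.Coord2 c₁ c₂ κ₁ κ₂ ε := by
  refine boxRatioSectionLaw_of_isSolvable_of_atomBad_local G (fun p q hp hq hpq hpd hqd hq5 => ?_) hG
  have hq' : q = 5 := by rcases h235 q hq hqd with h | h | h <;> omega
  subst hq'
  rcases h235 p hp hpd with rfl | rfl | rfl
  · exact SchmidtAtoms.atomBad_2_5
  · exact SchmidtAtoms.atomBad_3_5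
  · exact absurd rfl hpq

end Summit.MatrixMultiplication.OmegaCensus
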